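import Summits.CriticalPhenomena.PercolationContinuityZ3.Theorems.Transplant.FKConnectivityAllQAntipodalX2SpineDefs
import HarnessLib

/-!
# Connectivity correlation inequalities for `φ_{w,q}` — file (DEFINITION): the DUAL cross functional `X2∨` (the parallel twin of `X2`)
# and word duality

Definitions file (`--supports stmt-CriticalPhenomena-4575`), FK sub-lane `prim-bschramm-fk-2` (gen 14); builds on p205010 (kernel
theorem, internal audit signed; external expert review pending).  No named facts, no sorries; standard axioms.

CONTEXT (memo `bschramm/FROM-fk-2-g14-X2POS.md` §5.6).  Gen 12 factorised the split up-correlation functional of a PENDANT series core,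
`U¹¹(y·M) = q·V`, `q·V = q·U + (1-q)·X2`, and `X2 ≥ 0` is `FK.ApX2Pos` (gen 14).  The PARALLEL twin — `y = st` across the terminals of a
two-terminal series–parallel `M ∋ z = uv` — is its series–parallel DUAL, and dualising the factorisation gives (memo §5.6, exact in all
41,622 cells with `≤ 5` edges) `U¹¹(y ∥ M) = q^{σ}·[q²·U_{M/z} + (1-q)·X2∨(M; z)]` with the DUAL CROSS FUNCTIONAL
* `FK.apX2Dual q T s t u v h = ∑_{C ⊆ T} q^{k(C∪z)+k((T∖C)∪z)+1{s↔t in (T∖C)∪z}} · 1{s ↮ t in C ∪ z} · 1{u ↔ v in (T∖C) ∪ st} · (h(T∖C) - h(C))`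
  (the factor `q^{1{…}}` written as `q·c + (1 - c)` with `c = apConn (…) s t ∈ {0,1}`)
  ("`C ∪ z` does not join the terminals, while the complement joins the ends of `z` once the terminals are identified"), which equals
  `X2` of the dual network up to a power of `q` and is therefore nonnegative; the sibling files `…X2DualRows/Sem/Pos` prove
  `apX2Dual ≥ 0` DIRECTLY for every `q > 0` from `FK.X2Word.sigma_wordHall` applied to DUAL WORDS:
* `FK.dualLetter (k, b, b̄) = (k.other, ¬b, ¬b̄)` — the word of the dual configuration in the dual spine (kinds exchanged, bits complemented);
  the rows of a dual word are the kind-exchanged rows (`…X2DualRows`);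
* `FK.onesCount w = ∑ (b + b̄)`, `FK.seriesCount w = #{series letters}`, `FK.dualCoef` (bookkeeping of the dual exponent).
[cite: Grimmett2006, §1.4 eq. (1.20) (p. 15); §3.9 (p. 63); §6.1 (planar duality, pp. 133–136)]
-/

noncomputable section

namespace Summit.CriticalPhenomena.PercolationContinuityZ3.Theorems

namespace FK

open SimpleGraph Literature.Probability.LatticeModels Literature.Probability.Percolation X2Word
open scoped Classical

variable {V : Type*}

/-- **Dual cross functional `X2∨`** of the edge set `T` with terminals `s, t` and marked pair `u, v` (`z = uv` thought of as present on both
sides): `∑_{C ⊆ T} q^{k(C∪z)+k((T∖C)∪z)+1{s↔t in (T∖C)∪z}} · 1{s ↮ t in C ∪ z} · 1{u ↔ v in (T∖C) ∪ {st}} · (h(T∖C) - h(C))`, the factor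
`q^{1{s↔t in (T∖C)∪z}}` being written `q·c + (1 - c)` (memo g14 §5.6: the series–parallel dual of `FK.apX2`). [cite: Grimmett2006, §1.4 eq. (1.20) (p. 15); §6.1 (pp. 133–136)] -/
def apX2Dual (q : ℝ) (T : Finset (Sym2 V)) (s t u v : V) (h : Finset (Sym2 V) → ℝ) : ℝ :=
  ∑ C ∈ T.powerset,
    q ^ (clusterCount (↑(insert s(u, v) C) : BondConfig V) ∅ + clusterCount (↑(insert s(u, v) (T \ C)) : BondConfig V) ∅) *
      (q * apConn (insert s(u, v) (T \ C)) s t + (1 - apConn (insert s(u, v) (T \ C)) s t)) *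
      ((1 - apConn (insert s(u, v) C) s t) * apConn (insert s(s, t) (T \ C)) u v * (h (T \ C) - h C))

/-- The DUAL LETTER: kind exchanged, both bits complemented (the letter of the dual configuration in the dual spine, memo g14 §5.6). [folklore] -/
def dualLetter (l : SLetter) : SLetter := (l.1.other, !l.2.1, !l.2.2)

/-- Number of `1`-bits of a σ-word (`∑ (b + b̄)`; invariant under the flips `01 ↔ 10`). [folklore] -/
def onesCount (w : List SLetter) : ℕ := (w.map fun l : SLetter => (if l.2.1 then 1 else 0) + (if l.2.2 then 1 else 0)).sum

/-- Number of series letters of a σ-word. [folklore] -/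
def seriesCount (w : List SLetter) : ℕ := (w.map fun l : SLetter => if l.1 = Kind.W then 1 else 0).sum

/-- The word-dependent part of the weight of `X2∨` along a spine with `L` parts on `K` vertices, written through the DUAL word
(`…X2DualSem`: `k(C∪z)+k((T∖C)∪z)+1{…} = dualCoef-exponent + expSum`): `q^{2K + onesCount w + nP (dual w)} / q^{2LK + 2·seriesCount w + sRuns (dual w)}`.
[folklore] -/
def dualCoef (q : ℝ) (K L : ℕ) (w : List SLetter) : ℝ :=
  q ^ (2 * K + onesCount w + nP (w.map dualLetter)) / q ^ (2 * (L * K) + 2 * seriesCount w + sRuns (w.map dualLetter))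

/-! ### Unfolding lemmas -/

/-- `dualLetter` is an involution. [folklore] -/
@[simp] theorem dualLetter_dualLetter (l : SLetter) : dualLetter (dualLetter l) = l := by
  obtain ⟨k, b, bb⟩ := l; simp [dualLetter]

/-- Dualising a word twice gives the word back. [folklore] -/
@[simp] theorem map_dualLetter_map_dualLetter (w : List SLetter) : (w.map dualLetter).map dualLetter = w := by
  rw [List.map_map]; conv_rhs => rw [← List.map_id w]
  exact List.map_congr_left fun l _ => dualLetter_dualLetter l

/-- `dualLetter` commutes with the row exchange. [folklore] -/
theorem dualLetter_swapLetter (l : SLetter) : dualLetter (swapLetter l) = swapLetter (dualLetter l) := by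
  obtain ⟨k, b, bb⟩ := l; rfl

/-- `onesCount` of a `cons`. [folklore] -/
theorem onesCount_cons (l : SLetter) (w : List SLetter) :
    onesCount (l :: w) = ((if l.2.1 then 1 else 0) + (if l.2.2 then 1 else 0)) + onesCount w := by
  simp [onesCount]
/-- `onesCount` of the empty word. [folklore] -/
@[simp] theorem onesCount_nil : onesCount [] = 0 := rfl
/-- `seriesCount` of a `cons`. [folklore] -/
theorem seriesCount_cons (l : SLetter) (w : List SLetter) :
    seriesCount (l :: w) = (if l.1 = Kind.W then 1 else 0) + seriesCount w := by
  simp [seriesCount]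
/-- `seriesCount` of the empty word. [folklore] -/
@[simp] theorem seriesCount_nil : seriesCount [] = 0 := rfl

/-- Sanity instance of the letter bookkeeping. [folklore] -/
example : onesCount [(Kind.W, true, false), (Kind.P, true, true)] = 3 ∧ seriesCount [(Kind.W, true, false), (Kind.P, true, true)] = 1 := by
  decide

end FK

end Summit.CriticalPhenomena.PercolationContinuityZ3.Theorems

end
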